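import Summits.Schanuel.Schanuel.Theorems.RootDecomp1BSRLLogLiouville01
import Summits.Schanuel.Schanuel.Theorems.RootDecomp1EPointTransfer01

/-!
# RootDecomp1BHyperFrame — lens 4, generation 32 «HYPER-FRAME CELLS» (HyperFrame.lean f84fe52b…, 1151 l) — part 1 (RootDecomp1BHyperFrame01): §TrdegAlgebraic; §R the number-field typing `RoyNF` (`royDeg`, `royS`) + `roy_tree_iff`; §F the frame measure `FrameMeasure y e` and the bridge `frameMeasure_of_roy (hRoy)` (tree binder)

PORT NOTE (census-1 gen 15, 2026-08-31): port of HOME/decomp-schanuel-lens-4/g32/HyperFrame.lean (sha256 f84fe52b…46c4, 1151 l; own farm rc 0 · 0 warn · 0 sorry ·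
axioms std; critic VERDICT STATUS L1693: CHECKLIST B-g32 MET, ONE 1B cell-decision credit to lens-4 g32 (label VARIANT-REACH; engine credit lens-2's E-R16),
RULE B-R20, PORT GO LOW census lane) in FIVE parts `RootDecomp1BHyperFrame01`–`05` by the lens's cut plan (NODE §5): 01 = §TrdegAlgebraic + §R + §F
(`RoyNF`, `roy_tree_iff`, `FrameMeasure`, bridge `frameMeasure_of_roy`), 02 = §E lemmas, 03 = §E ENGINE `algebraicIndependent_cons_of_frameMeasure`, 04 = §P
hyper-scaled frames / E-line / mixed flags through `atCells_hyperFlag`, 05 = §P storey two (1 | ρβ′) / boundary / √2-column / members. ONE-ENGINE RULE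
(critic L1661/L1667/L1693, lens addendum L1692): the named fact is the TREE's `…RootDecomp1EPointTransfer.Roy2014_thm_1_1` (lens 2, p812187), opened
by name — this file's own def is kept as the auxiliary number-field typing `RoyNF`, `roy_tree_iff : Roy2014_thm_1_1 ↔ RoyNF` is ported from the lens's
HyperFrameProbeTree.lean (082a543d…, farm-checked against the live tree), and `frameMeasure_of_roy` takes the TREE binder (first proof line re-keys it);
every downstream `(hRoy : Roy2014_thm_1_1)` therefore denotes the tree fact — statement texts unchanged. `import …Theses.RootDecomp1B` dropped (no decl uses
it); `set_option linter.dupNamespace false` dropped; 15 one-line docstrings added; `isIntegral_intCast_HF`, `pow_clear_HF`, `eq_of_zero_eq_of_tail_eq`,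
`exp_neg_lt_of_inv_lt_HF` made `private` (per-part copies); proofs otherwise verbatim. `--supports stmt-Schanuel-24622` (At-cells of 32406/32407/32408 inside);
no census credit. Nothing here proves Schanuel; rung 0. The lens's header follows.
-/

/-!
# RootDecomp1BHyperFrame — HYPER-SCALED KLEIN-POLAR FRAMES on 1B (lens 4 «minimal-counterexample / extremal
reduction», gen 32; VARIANT-REACH of the lens-2 gen-36 POINT-TRANSFER engine, critic ACK STATUS L1653)

Route of record `route-Schanuel-RootDecomp1B` (X = `KleinPolarSchanuel`, stmt-Schanuel-24622; node rev 32,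
X ⟸ LSB ∧ Free ∧ Tight ∧ SRL ∧ T0 ∧ W0 ∧ NoWildAbsorbingSlackFirstFailure).  Nothing here proves Schanuel or X;
rung 0; every cell below is a theorem MODULO ONE NAMED PRINT FACT carried as a hypothesis binder `hRoy`:

* §R `Roy2014_thm_1_1` — D. Roy, «Sur le théorème de Lindemann–Weierstrass effectif» (L'Enseignement Math. 59
  (2013) 307–324 = arXiv:1607.00579), Théorème 1.1, typed in PRINT SHAPE: for α₁,…,α_t ∈ ℚ̄ ℚ-linearly independent,
  `c` a bound for the absolute values of all their conjugates, `q ∈ ℕ₊` with `qα_i` algebraic integers,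
  `d = [ℚ(α):ℚ]`, and every non-zero `P ∈ ℤ[X₁..X_t]` of (total) degree `≤ D`, coefficients `≤ H` in absolute value
  (`D, H ≥ 1`):  `|P(e^{α₁},…,e^{α_t})| ≥ H^{-3dS^t} · exp(−(cqS)^{18S^t})`, `S = 6dt(t!)D`.
  The point of this fact (versus the tree's `LWMeasure`, Ably's form, whose constants depend on the point in an
  UNCONTROLLED way) is that the dependence on the POINT α is EXPLICIT through `(c, q, d)` only.
* §F `FrameMeasure y e` — the uniform measure it yields along a RATIONAL FRAME: for a fixed algebraic ℚ-free
  `y ∈ ℚ̄ⁿ` and exponents `e : Fin n → ℕ`, the moving points `α_r = (r^{e_j} y_j)_j` (`r ∈ ℚˣ`) all live in the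
  FIXED number field `ℚ(y)`, with house `≪ (|num r| + den r)^{max e}` and denominator `q_y · (den r)^{max e}`; so
  `|P(e^{α_r})| ≥ exp(−C_D (log H + (|num r| + den r)^{N_D}))` UNIFORMLY in `r` (`frameMeasure_of_roy`).
* §E THE ENGINE `algebraicIndependent_cons_of_frameMeasure`: `FrameMeasure y e` + `ρ` HYPER-Liouville
  (`|ρ − a/b| < exp(−b^m)` for every `m`, tree `HyperLiouville`) ⟹ `ρ, e^{ρ^{e₁}y₁}, …, e^{ρ^{eₙ}yₙ}` are
  ALGEBRAICALLY INDEPENDENT.  (Mahler's transfer: `P(ρ, e^{ρ^e y}) = 0`, `F(x) = P(x, e^{x^e y})` is `C¹`, so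
  `|F(a/b)| ≪ exp(−b^m)`; clearing the first variable, `b^{deg} F(a/b) = Q_{a/b}(e^{α_{a/b}})` with
  `Q_{a/b} ∈ ℤ[X]` of the same degree, height `≪ ((|ρ|+2)b)^{deg}`, non-zero for `a/b` near `ρ`; the frame measure
  gives `exp(−C·b^N) ≤ |Q(e^{α})|`, impossible for `m ≫ N`.)  The SCALE reached is hyper-Liouville — one
  exponential below the ULTRA-Liouville scale `exp(−b^{b^m})` that the tree's `LWMeasure` forces (lens 4 g30/g31).
* §P CELLS ON 1B (all mod `hRoy`; `t(r) = polarDeg r = trdeg_ℚ ℚ(r, ir, e^r, e^{ir})`):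
  for `γ ∈ (ℚ̄ ∩ ℝ)^M` ℚ-free, `ε : Fin M → {0,1}` not identically 0, `ρ` hyper-Liouville and the HYPER-FRAME
  `r_i = ρ^{ε_i} γ_i`:  **`t(r) ≥ 2M + 1`** (`polarDeg_hyperFrame_ge`) and `r` is ℚ-free — so
  - the E-LINE `r = ρ·β` (ε ≡ 1, β ∈ (ℚ̄∩ℝ)^M ℚ-free, M ≥ 1): **X(M) HOLDS AT r** with surplus ≥ 1, every M;
  - MIXED FLAGS `(β | ρβ′)` (β ∈ (ℚ̄∩ℝ)^m, β′ real algebraic, (β,β′) ℚ-free): `t ≥ 2m + 3` over the SHARP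
    hyperplane β (`t(β) ≤ 2m`): the At-instances of SRL / W0 / W0Init (and X(m+1)) hold at these flags, every m;
  - (L+) THE LOCALISATION THEOREM `cell_storeyTwo`: STOREY TWO `(1 | ρβ′)` for EVERY real algebraic IRRATIONAL
    `β′`: `t(1, ρβ′) ≥ 5` (X(2) with surplus one, `kleinPolarSchanuel_at_storeyTwo` in X's literal text) at
    HYPER-Liouville scale, init `(1)` sharp, the SRL/T0/W0/W0Init At-cells there decided;
  - (L−) THE BOUNDARY `not_linearIndependent_frame_one_rat` / `_polarVec_one_rat` / `_one_I_rat`: at `β′ = q ∈ ℚ`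
    the frame `(1, q)` and the moving L–W point `(1, i, q, iq)` are NOT ℚ-free (proved), so the engine's hypothesis
    fails EXACTLY there — the column `(1 | ρ)` needs ULTRA-Liouville ρ (lens 4 g30); the wall is the ℚ-freeness of
    the FRAME `(β | β′)`, witness: the column `(√2 | ρ)` (frame `(√2, 1)`, β′ = 1 rational) IS reached,
    `cell_sqrt_two_column`.
  Members (ℚ-freeness certified WITHOUT `hRoy`; `ρ = λ_H`, tree `hyperLiouville_lambdaH` cited not copied):
  `(1, λ_H√2)` (storey two), `λ_H·(1, √2)` (E-line M = 2), `(√2, λ_H)` (mixed flag, rational β′) — each `t ≥ 5`.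
Sorry-free; axioms standard; imports tree modules only.  Credit: engine idea = lens-2 g36 point transfer
(Roy 2014 Thm 1.1 as binder); this file = its 1B variant (mixed exponents, ρ adjoined, Klein-polar frames).
-/

noncomputable section

open Complex IntermediateField MvPolynomial

namespace Summit.Schanuel.Schanuel.Theorems.RootDecomp1BHyperFrame

-- PORT (census-1 gen 15, ONE-ENGINE rule critic L1661/L1667/VERDICT L1693): the named fact `Roy2014_thm_1_1` used below is the
-- TREE's (lens-2-owned) `Summit.Schanuel.Schanuel.Theorems.RootDecomp1EPointTransfer.Roy2014_thm_1_1` (Theorems/RootDecomp1EPointTransfer01,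
-- p812187); this file's own number-field typing is kept as the auxiliary `RoyNF`, certified equivalent by `roy_tree_iff` (from
-- the lens's HyperFrameProbeTree.lean 082a543d…), and the bridge `frameMeasure_of_roy` is re-keyed to the tree binder.
open Summit.Schanuel.Schanuel.Theorems.RootDecomp1EPointTransfer (Roy2014_thm_1_1)

open Summit.Schanuel.Schanuel.Theorems.RootDecomp1KHyper (mvlen mvlen_nonneg abs_coeff_le_mvlen one_le_mvlen
  exists_int_mul_eq_map mvaeval_int_map exists_ball_eval_ne_zero transcendental_ofReal_of_liouville)
open Summit.Schanuel.Schanuel.Theorems.RootDecomp1KHyper.HyperCell (HyperLiouville lambdaH hyperLiouville_lambdaH)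
open Summit.Schanuel.Schanuel.Theorems.RootDecomp1BFedFlagCore (KleinIH polarDeg polarField polarGens
  coe_mem_polarField coe_mul_I_mem_polarField exp_coe_mem_polarField exp_coe_mul_I_mem_polarField)
open Summit.Schanuel.Schanuel.Theorems.RootDecomp1BTameFlagCore (IsWild isAlgebraic_I)
open Summit.Schanuel.Schanuel.Theorems.RootDecomp1BDefectFloorDefs (SharpRelativeLindemannAt TameDefectZeroAt
  WildSharpDefectZeroAt WildSharpDefectZeroInitAt WildSharpInitAt)
open Summit.Schanuel.Schanuel.Theorems.RootDecomp1BDefectFloorCells (polarDeg_le_two_mul_of_algebraic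
  isAlgebraic_of_mem_span_algebraic natCast_le_trdeg_of_algebraicIndependent linearIndependent_polar
  isAlgebraic_polarExp)
open Summit.Schanuel.Schanuel.Theorems.RootDecomp1BSRLLogLiouville (sharp_init_snoc)

section TrdegAlgebraic

/-- If every element of `T` is algebraic over `K` then `trdeg_ℚ ℚ(T) ≤ trdeg_ℚ K` [folklore] (the Literature lemma
`trdeg_adjoin_le_of_isAlgebraic` of `PrasadRapinchukLengths`, re-proved verbatim to keep this file's import closure
inside the route's modules). -/
theorem trdeg_adjoin_le_of_isAlgebraic' (K : IntermediateField ℚ ℂ) {T : Set ℂ}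
    (hT : ∀ x ∈ T, IsAlgebraic K x) : Algebra.trdeg ℚ (IntermediateField.adjoin ℚ T) ≤ Algebra.trdeg ℚ K := by
  have hmono : Algebra.trdeg ℚ (IntermediateField.adjoin ℚ T) ≤
      Algebra.trdeg ℚ (IntermediateField.adjoin ℚ ((K : Set ℂ) ∪ T)) :=
    trdeg_le_of_injective
      (IntermediateField.inclusion (adjoin.mono ℚ _ _ Set.subset_union_right))
      (IntermediateField.inclusion_injective _)
  refine hmono.trans ?_
  haveI : Algebra.IsAlgebraic K (IntermediateField.adjoin K T) :=
    isAlgebraic_adjoin fun x hx => (hT x hx).isIntegral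
  have h := trdeg_add_eq ℚ K (A := IntermediateField.adjoin K T)
  rw [trdeg_eq_zero (R := K) (A := IntermediateField.adjoin K T), add_zero] at h
  have e := (equivOfEq (restrictScalars_adjoin ℚ K T)).symm.trdeg_eq
  calc Algebra.trdeg ℚ (IntermediateField.adjoin ℚ ((K : Set ℂ) ∪ T))
      = Algebra.trdeg ℚ ((IntermediateField.adjoin K T).restrictScalars ℚ) := e
    _ = Algebra.trdeg ℚ (IntermediateField.adjoin K T) := rfl
    _ = Algebra.trdeg ℚ K := h.symm
    _ ≤ Algebra.trdeg ℚ K := le_rfl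

end TrdegAlgebraic

/-! ## §R  The named print fact: Roy's effective Lindemann–Weierstrass theorem -/

/-- `d = [ℚ(α₁,…,α_t) : ℚ]`, the degree entering Roy's Theorem 1.1. -/
def royDeg {t : ℕ} (α : Fin t → ℂ) : ℕ :=
  Module.finrank ℚ ↥(IntermediateField.adjoin ℚ (Set.range α))

/-- `S = 6·d·t·(t!)·D`, the auxiliary parameter of Roy's Theorem 1.1. -/
def royS (t d D : ℕ) : ℕ := 6 * d * t * t.factorial * D

/-- **Number-field typing `RoyNF` of Roy's effective Lindemann–Weierstrass theorem** (D. Roy, *Sur le théorème de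
Lindemann–Weierstrass effectif*, L'Enseignement Math. (2) 59 (2013) 307–324, Thm 1.1, arXiv:1607.00579; doi
10.4171/LEM/59-3-4).  PORT: the NAMED FACT of record is the tree's `…RootDecomp1EPointTransfer.Roy2014_thm_1_1`
(lens 2, cite-tagged there); this typing is EQUIVALENT to it (`roy_tree_iff` below) and is used only as the adapter's
target inside `frameMeasure_of_roy`.  PRINT SHAPE: `α₁, …, α_t ∈ ℂ` algebraic and ℚ-linearly independent (here: elements
of a number field `K ⊂ ℂ`, `[K:ℚ] < ∞`); `c` bounds the absolute values of all their conjugates (= all `σ(α_i)`,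
`σ : K → ℂ`); `q ∈ ℕ₊` makes every `qα_i` an algebraic integer; `d = [ℚ(α₁,…,α_t):ℚ]`; then for all positive integers
`D, H` and every non-zero `P ∈ ℤ[X₁,…,X_t]` of degree `≤ D` with coefficients of absolute value `≤ H`:
`|P(e^{α₁},…,e^{α_t})| ≥ H^{−3dS^t} · exp(−(cqS)^{18 S^t})`, `S = 6dt(t!)D`. -/
def RoyNF : Prop :=
  ∀ (t : ℕ) (K : IntermediateField ℚ ℂ), FiniteDimensional ℚ ↥K →
    ∀ (α : Fin t → ↥K), LinearIndependent ℚ (fun i => (α i : ℂ)) →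
    ∀ (c : ℝ), (∀ (i : Fin t) (σ : ↥K →ₐ[ℚ] ℂ), ‖σ (α i)‖ ≤ c) →
    ∀ (q : ℕ), 0 < q → (∀ i, IsIntegral ℤ ((q : ℂ) * (α i : ℂ))) →
    ∀ (D H : ℕ), 0 < D → 0 < H →
    ∀ (P : MvPolynomial (Fin t) ℤ), P ≠ 0 → P.totalDegree ≤ D → (∀ s, |P.coeff s| ≤ (H : ℤ)) →
      ((H : ℝ) ^ (3 * royDeg (fun i => (α i : ℂ)) * royS t (royDeg fun i => (α i : ℂ)) D ^ t))⁻¹ *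
          Real.exp (-((c * (q : ℝ) * (royS t (royDeg fun i => (α i : ℂ)) D : ℝ)) ^
            (18 * royS t (royDeg fun i => (α i : ℂ)) D ^ t))) ≤
        ‖MvPolynomial.aeval (fun i => Complex.exp (α i : ℂ)) P‖

/-- **The tree's (lens-2-owned) typing `Roy2014_thm_1_1` of Roy's Theorem 1.1 and this file's number-field
typing `RoyNF` are equivalent** (lens 4, HyperFrameProbeTree.lean §Tree, verbatim up to the renaming; PORT). -/
theorem roy_tree_iff : Roy2014_thm_1_1 ↔ RoyNF := by
  constructor
  · intro h t K hK α hli c hc q hq hint D H hD hH P hP hdeg hcoef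
    have halg : ∀ i, IsAlgebraic ℚ (α i : ℂ) := fun i =>
      IntermediateField.isAlgebraic_iff.mp (Algebra.IsAlgebraic.isAlgebraic (α i))
    have := h t (fun i => (α i : ℂ)) halg hli K (fun i => (α i).2) hK c (fun σ i => hc i σ) q hq hint
      (royDeg fun i => (α i : ℂ)) rfl D H hD hH P hP hdeg hcoef
    simpa [Summit.Schanuel.Schanuel.Theorems.RootDecomp1EPointTransfer.royBound,
      Summit.Schanuel.Schanuel.Theorems.RootDecomp1EPointTransfer.royS, royS] using this
  · intro h t α halg hli F hF hFd c hc q hq hint d hd D H hD hH P hP hdeg hcoef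
    subst hd
    have := h t F hFd (fun i => ⟨α i, hF i⟩) hli c (fun i σ => hc σ i) q hq hint D H hD hH P hP hdeg hcoef
    simpa [Summit.Schanuel.Schanuel.Theorems.RootDecomp1EPointTransfer.royBound,
      Summit.Schanuel.Schanuel.Theorems.RootDecomp1EPointTransfer.royS, royS, royDeg] using this

/-! ## §F  The frame measure -/

/-- **FRAME MEASURE** of the rational frame `r ↦ α_r = (r^{e_j} y_j)_j` through `y`: for every degree `D` there are
`C ≥ 0` and `N` with `|P(e^{α_r})| ≥ exp(−C (log H + (|num r| + den r)^N))` for all `r ∈ ℚˣ` and all non-zero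
`P ∈ ℤ[X₁..Xₙ]` of total degree `≤ D` and coefficients `≤ H` (`H ≥ 1`) in absolute value. -/
def FrameMeasure {n : ℕ} (y : Fin n → ℂ) (e : Fin n → ℕ) : Prop :=
  ∀ D : ℕ, ∃ (C : ℝ) (N : ℕ), 0 ≤ C ∧ ∀ r : ℚ, r ≠ 0 →
    ∀ P : MvPolynomial (Fin n) ℤ, P ≠ 0 → P.totalDegree ≤ D →
    ∀ H : ℕ, 1 ≤ H → (∀ s, |P.coeff s| ≤ (H : ℤ)) →
      Real.exp (-(C * (Real.log H + (((|r.num| : ℤ) : ℝ) + (r.den : ℝ)) ^ N))) ≤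
        ‖MvPolynomial.aeval (fun j => Complex.exp ((((r : ℝ) : ℂ)) ^ (e j) * y j)) P‖

/-- An integer is an algebraic integer in `ℂ`. -/
private theorem isIntegral_intCast_HF (z : ℤ) : IsIntegral ℤ (z : ℂ) := by
  simpa using (isIntegral_algebraMap (R := ℤ) (A := ℂ) (x := z))

/-- **Roy ⟹ frame measure.**  Along the frame the number field `K = ℚ(y)` is FIXED; house and denominator of
`α_r` are polynomial in `(|num r| + den r)`; Roy's bound is then uniform of the stated shape. -/
theorem frameMeasure_of_roy (hRoy : Roy2014_thm_1_1) {n : ℕ} {y : Fin n → ℂ}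
    (hyalg : ∀ j, IsAlgebraic ℚ (y j)) (hy : LinearIndependent ℚ y) (e : Fin n → ℕ) :
    FrameMeasure y e := by
  -- PORT: re-key the tree binder to this file's number-field typing
  have hRoy : RoyNF := roy_tree_iff.mp hRoy
  classical
  -- the fixed number field `K = ℚ(y)`
  set K : IntermediateField ℚ ℂ := IntermediateField.adjoin ℚ (Set.range y) with hKdef
  haveI hKfd : FiniteDimensional ℚ ↥K :=
    IntermediateField.finiteDimensional_adjoin fun x hx => by
      obtain ⟨j, rfl⟩ := hx
      exact (hyalg j).isIntegral
  have hyK : ∀ j, y j ∈ K := fun j => IntermediateField.subset_adjoin ℚ _ ⟨j, rfl⟩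
  let yK : Fin n → ↥K := fun j => ⟨y j, hyK j⟩
  -- a bound `c₀ ≥ 1` for the house of every `y_j`
  let c₀ : ℝ := 1 + ∑ j, ∑ σ : ↥K →ₐ[ℚ] ℂ, ‖σ (yK j)‖
  have hsum0 : 0 ≤ ∑ j, ∑ σ : ↥K →ₐ[ℚ] ℂ, ‖σ (yK j)‖ :=
    Finset.sum_nonneg fun _ _ => Finset.sum_nonneg fun _ _ => norm_nonneg _
  have hc₀1 : 1 ≤ c₀ := by simp only [c₀]; linarith
  have hc₀0 : 0 ≤ c₀ := le_trans zero_le_one hc₀1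
  have hc₀ : ∀ j (σ : ↥K →ₐ[ℚ] ℂ), ‖σ (yK j)‖ ≤ c₀ := by
    intro j σ
    have h1 : ‖σ (yK j)‖ ≤ ∑ τ : ↥K →ₐ[ℚ] ℂ, ‖τ (yK j)‖ :=
      Finset.single_le_sum (f := fun τ : ↥K →ₐ[ℚ] ℂ => ‖τ (yK j)‖) (fun _ _ => norm_nonneg _)
        (Finset.mem_univ σ)
    have h2 : (∑ τ : ↥K →ₐ[ℚ] ℂ, ‖τ (yK j)‖) ≤ ∑ j', ∑ τ : ↥K →ₐ[ℚ] ℂ, ‖τ (yK j')‖ :=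
      Finset.single_le_sum (f := fun j' => ∑ τ : ↥K →ₐ[ℚ] ℂ, ‖τ (yK j')‖)
        (fun _ _ => Finset.sum_nonneg fun _ _ => norm_nonneg _) (Finset.mem_univ j)
    simp only [c₀]; linarith
  -- a common denominator `q₀ ≥ 1` of the `y_j`
  have hint : ∀ j, ∃ N : ℤ, N ≠ 0 ∧ IsIntegral ℤ ((N : ℂ) * y j) := by
    intro j
    have halgZ : IsAlgebraic ℤ (y j) := (IsFractionRing.isAlgebraic_iff ℤ ℚ ℂ).mpr (hyalg j)
    obtain ⟨N, hN0, hN⟩ := halgZ.exists_integral_multiple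
    exact ⟨N, hN0, by simpa [zsmul_eq_mul] using hN⟩
  choose Nj hN0 hNint using hint
  let M : ℤ := ∏ j, Nj j
  have hM0 : M ≠ 0 := Finset.prod_ne_zero_iff.mpr fun j _ => hN0 j
  have hMint : ∀ j, IsIntegral ℤ ((M : ℂ) * y j) := by
    intro j
    have hsplit : (M : ℂ) = ((∏ k ∈ Finset.univ.erase j, Nj k : ℤ) : ℂ) * (Nj j : ℂ) := by
      rw [← Int.cast_mul, Finset.prod_erase_mul _ _ (Finset.mem_univ j)]
    rw [hsplit, mul_assoc]
    exact (isIntegral_intCast_HF _).mul (hNint j)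
  let q₀ : ℕ := (M * M).toNat
  have hq₀Z : (q₀ : ℤ) = M * M := Int.toNat_of_nonneg (mul_self_nonneg M)
  have hq₀pos : 0 < q₀ := by
    have h : (0 : ℤ) < M * M := mul_self_pos.mpr hM0
    have h' : (0 : ℤ) < (q₀ : ℤ) := by rw [hq₀Z]; exact h
    exact_mod_cast h'
  have hq₀C : (q₀ : ℂ) = (M : ℂ) * M := by
    have h : ((q₀ : ℤ) : ℂ) = ((M * M : ℤ) : ℂ) := by rw [hq₀Z]
    push_cast at h
    exact h
  have hq₀int : ∀ j, IsIntegral ℤ ((q₀ : ℂ) * y j) := by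
    intro j
    rw [hq₀C, mul_assoc]
    exact (isIntegral_intCast_HF _).mul (hMint j)
  -- the largest exponent
  let emax : ℕ := Finset.univ.sup e
  have he : ∀ j, e j ≤ emax := fun j => Finset.le_sup (f := e) (Finset.mem_univ j)
  -- the degree `d₀ = [K:ℚ]` and the constants
  let d₀ : ℕ := Module.finrank ℚ ↥K
  intro D
  let D' : ℕ := D + 1
  let S₀ : ℕ := royS n d₀ D'
  let A : ℕ := 3 * d₀ * S₀ ^ n
  let E : ℕ := 18 * S₀ ^ n
  let B : ℝ := (c₀ * q₀ * S₀) ^ E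
  have hB : 0 ≤ B := pow_nonneg (mul_nonneg (mul_nonneg hc₀0 (Nat.cast_nonneg _)) (Nat.cast_nonneg _)) E
  refine ⟨(A : ℝ) + B, 2 * emax * E, add_nonneg (Nat.cast_nonneg _) hB, ?_⟩
  intro r hr P hP hPD H hH hPH
  set T : ℝ := ((|r.num| : ℤ) : ℝ) + (r.den : ℝ) with hTdef
  have hden1 : (1 : ℝ) ≤ r.den := by exact_mod_cast r.den_pos
  have hnum0 : (0 : ℝ) ≤ ((|r.num| : ℤ) : ℝ) := by exact_mod_cast abs_nonneg r.num
  have hT1 : 1 ≤ T := by simp only [hTdef]; linarith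
  have hT0 : 0 ≤ T := le_trans zero_le_one hT1
  have hdenT : (r.den : ℝ) ≤ T := by simp only [hTdef]; linarith
  -- |r| ≤ |num r| ≤ T
  have hrabs : |(r : ℝ)| ≤ T := by
    have hr' : (r : ℝ) = (r.num : ℝ) / (r.den : ℝ) := by rw [Rat.cast_def]
    rw [hr', abs_div, abs_of_pos (by positivity : (0 : ℝ) < r.den)]
    have h1 : |(r.num : ℝ)| / (r.den : ℝ) ≤ |(r.num : ℝ)| := div_le_self (abs_nonneg _) hden1
    have h3 : |(r.num : ℝ)| = ((|r.num| : ℤ) : ℝ) := (Int.cast_abs).symm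
    simp only [hTdef]; linarith [show (0 : ℝ) ≤ r.den by positivity]
  have hrC : ‖(r : ℂ)‖ = |(r : ℝ)| := by
    rw [← Complex.ofReal_ratCast, Complex.norm_real, Real.norm_eq_abs]
  have hrpowle : ∀ j, ‖((r : ℂ)) ^ (e j)‖ ≤ T ^ emax := by
    intro j
    rw [norm_pow, hrC]
    calc |(r : ℝ)| ^ e j ≤ T ^ e j := pow_le_pow_left₀ (abs_nonneg _) hrabs _
      _ ≤ T ^ emax := pow_le_pow_right₀ hT1 (he j)
  -- the point `α_r` of `K`
  let rK : ↥K := ((r : ℚ) : ↥K)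
  let α : Fin n → ↥K := fun j => rK ^ (e j) * yK j
  have hαcoe : ∀ j, (α j : ℂ) = ((r : ℂ)) ^ (e j) * y j := by
    intro j
    show (((rK ^ (e j) * yK j : ↥K)) : ℂ) = _
    rw [IntermediateField.coe_mul, IntermediateField.coe_pow]
    simp only [rK, yK, SubfieldClass.coe_ratCast]
  -- ℚ-linear independence of `α_r`
  have hrpow : ∀ j, (r : ℚ) ^ (e j) ≠ 0 := fun j => pow_ne_zero _ hr
  have hαli : LinearIndependent ℚ (fun j => (α j : ℂ)) := by
    have h := hy.units_smul (fun j => Units.mk0 _ (hrpow j))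
    convert h using 1
    funext j
    rw [hαcoe j, Pi.smul_apply', Units.smul_def, Units.val_mk0, Rat.smul_def, Rat.cast_pow]
  -- the house of `α_r`
  have hconj : ∀ j (σ : ↥K →ₐ[ℚ] ℂ), ‖σ (α j)‖ ≤ c₀ * T ^ emax := by
    intro j σ
    have hσ : σ (α j) = ((r : ℂ)) ^ (e j) * σ (yK j) := by
      show σ (rK ^ (e j) * yK j) = _
      rw [map_mul, map_pow]
      simp only [rK, map_ratCast]
    rw [hσ, norm_mul]
    calc ‖(r : ℂ) ^ e j‖ * ‖σ (yK j)‖ ≤ T ^ emax * c₀ :=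
        mul_le_mul (hrpowle j) (hc₀ j σ) (norm_nonneg _) (pow_nonneg hT0 _)
      _ = c₀ * T ^ emax := mul_comm _ _
  -- the denominator of `α_r`
  let qr : ℕ := q₀ * r.den ^ emax
  have hqrpos : 0 < qr := Nat.mul_pos hq₀pos (pow_pos r.den_pos _)
  have hdenC : (r : ℂ) * (r.den : ℂ) = (r.num : ℂ) := by
    rw [← Rat.cast_natCast, ← Rat.cast_mul, Rat.mul_den_eq_num, Rat.cast_intCast]
  have hqrint : ∀ j, IsIntegral ℤ ((qr : ℂ) * (α j : ℂ)) := by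
    intro j
    have hsplit : (r.den : ℂ) ^ emax = (r.den : ℂ) ^ (e j) * (r.den : ℂ) ^ (emax - e j) := by
      rw [← pow_add, Nat.add_sub_cancel' (he j)]
    have hkey : (qr : ℂ) * (((r : ℂ)) ^ (e j) * y j) =
        (((r.num ^ (e j) * (r.den : ℤ) ^ (emax - e j) : ℤ)) : ℂ) * ((q₀ : ℂ) * y j) := by
      have hq : (qr : ℂ) = (q₀ : ℂ) * (r.den : ℂ) ^ emax := by simp only [qr]; push_cast; ring
      rw [hq, hsplit]
      push_cast
      rw [← hdenC, mul_pow]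
      ring
    rw [hαcoe j, hkey]
    exact (isIntegral_intCast_HF _).mul (hq₀int j)
  -- Roy's theorem at `α_r`
  have hD' : 0 < D' := Nat.succ_pos D
  have hPD' : P.totalDegree ≤ D' := hPD.trans (Nat.le_succ D)
  have hroy := hRoy n K hKfd α hαli (c₀ * T ^ emax) hconj qr hqrpos hqrint D' H hD' hH P hP hPD' hPH
  -- `ℚ(α_r) = K`, so `d = d₀`
  have hadj : IntermediateField.adjoin ℚ (Set.range fun j => (α j : ℂ)) = K := by
    apply le_antisymm
    · rw [IntermediateField.adjoin_le_iff]
      rintro _ ⟨j, rfl⟩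
      exact (α j).2
    · show IntermediateField.adjoin ℚ (Set.range y) ≤ _
      rw [IntermediateField.adjoin_le_iff]
      rintro _ ⟨j, rfl⟩
      have hmem : (α j : ℂ) ∈ IntermediateField.adjoin ℚ (Set.range fun j => (α j : ℂ)) :=
        IntermediateField.subset_adjoin ℚ _ ⟨j, rfl⟩
      have hrj : ((r : ℂ)) ^ (e j) ≠ 0 := pow_ne_zero _ (by exact_mod_cast hr)
      have : y j = ((r ^ e j)⁻¹ : ℚ) • (α j : ℂ) := by
        rw [hαcoe j, Rat.smul_def, Rat.cast_inv, Rat.cast_pow, ← mul_assoc, inv_mul_cancel₀ hrj, one_mul]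
      rw [this]
      exact IntermediateField.smul_mem _ hmem
  have hdeg : royDeg (fun j => (α j : ℂ)) = d₀ := by
    show Module.finrank ℚ ↥(IntermediateField.adjoin ℚ (Set.range fun j => (α j : ℂ))) = Module.finrank ℚ ↥K
    rw [hadj]
  rw [hdeg] at hroy
  have hpt : (fun i => Complex.exp (α i : ℂ)) = fun j => Complex.exp ((((r : ℝ) : ℂ)) ^ (e j) * y j) := by
    funext j; rw [hαcoe j, Complex.ofReal_ratCast]
  rw [hpt] at hroy
  refine le_trans ?_ hroy
  -- compare the two shapes
  have hHpos : (0 : ℝ) < H := by exact_mod_cast hH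
  have hlogH : 0 ≤ Real.log H := Real.log_nonneg (by exact_mod_cast hH)
  have hHA : ((H : ℝ) ^ A)⁻¹ = Real.exp (-(A * Real.log H)) := by
    rw [← Real.log_pow, Real.exp_neg, Real.exp_log (pow_pos hHpos A)]
  have hqr_le : (qr : ℝ) ≤ q₀ * T ^ emax := by
    have h1 : (r.den : ℝ) ^ emax ≤ T ^ emax := pow_le_pow_left₀ (by positivity) hdenT _
    have h2 : (qr : ℝ) = (q₀ : ℝ) * (r.den : ℝ) ^ emax := by simp only [qr]; push_cast; ring
    rw [h2]
    exact mul_le_mul_of_nonneg_left h1 (Nat.cast_nonneg _)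
  have hbase : c₀ * T ^ emax * (qr : ℝ) * (S₀ : ℝ) ≤ c₀ * q₀ * S₀ * (T ^ emax) ^ 2 := by
    have h1 : c₀ * T ^ emax * (qr : ℝ) * (S₀ : ℝ) ≤ c₀ * T ^ emax * (q₀ * T ^ emax) * (S₀ : ℝ) :=
      mul_le_mul_of_nonneg_right
        (mul_le_mul_of_nonneg_left hqr_le (mul_nonneg hc₀0 (pow_nonneg hT0 _))) (Nat.cast_nonneg _)
    calc _ ≤ _ := h1
      _ = c₀ * q₀ * S₀ * (T ^ emax) ^ 2 := by ring
  have hpowE : (c₀ * T ^ emax * (qr : ℝ) * (S₀ : ℝ)) ^ E ≤ B * T ^ (2 * emax * E) := by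
    have h0 : 0 ≤ c₀ * T ^ emax * (qr : ℝ) * (S₀ : ℝ) :=
      mul_nonneg (mul_nonneg (mul_nonneg hc₀0 (pow_nonneg hT0 _)) (Nat.cast_nonneg _)) (Nat.cast_nonneg _)
    calc (c₀ * T ^ emax * (qr : ℝ) * (S₀ : ℝ)) ^ E ≤ (c₀ * q₀ * S₀ * (T ^ emax) ^ 2) ^ E :=
        pow_le_pow_left₀ h0 hbase E
      _ = B * T ^ (2 * emax * E) := by
        simp only [B]
        rw [mul_pow, ← pow_mul, ← pow_mul]
        ring_nf
  have hexp : A * Real.log H + (c₀ * T ^ emax * (qr : ℝ) * (S₀ : ℝ)) ^ E ≤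
      ((A : ℝ) + B) * (Real.log H + T ^ (2 * emax * E)) := by
    have hTN : 0 ≤ T ^ (2 * emax * E) := pow_nonneg hT0 _
    have hA : (0 : ℝ) ≤ A := Nat.cast_nonneg _
    nlinarith [hpowE, hlogH, hB, hTN, hA, mul_nonneg hA hTN, mul_nonneg hB hlogH]
  calc Real.exp (-(((A : ℝ) + B) * (Real.log H + T ^ (2 * emax * E))))
      ≤ Real.exp (-(A * Real.log H + (c₀ * T ^ emax * (qr : ℝ) * (S₀ : ℝ)) ^ E)) :=
        Real.exp_le_exp.mpr (neg_le_neg hexp)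
    _ = ((H : ℝ) ^ A)⁻¹ * Real.exp (-((c₀ * T ^ emax * (qr : ℝ) * (S₀ : ℝ)) ^ E)) := by
        rw [neg_add, Real.exp_add, hHA]

end Summit.Schanuel.Schanuel.Theorems.RootDecomp1BHyperFrame

end
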